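import Summits.ValiantsHypothesis.ValiantsHypothesis.Theses.GrenetZeon
import Summits.ValiantsHypothesis.ValiantsHypothesis.Theorems.GrenetZeonDualUnipotentThreeHalvesSlowCoreGlueLocal

/-!
# `GrenetZeon.DualUnipotentThreeHalves` (stmt-ValiantsHypothesis-24318), line `slow_core`:
# THE CRUX NEEDS (c) ONLY ON THE CONSTITUENTS OF `per_n`-REPRESENTING PENCILS — a kernel-checked WEAKER sufficient law

The registered research stub of the line is (c) `SlowCore.LongMassSlowLawInv`: EVERY irreducible nilpotent affine pencil `B` of size `b` over the
`n²` coordinates has `RelCert n b B (c·(⌊√n⌋·b))`.  The glue ✓ `slow_of_longMassSlowLawInv` + S1/S2 close the crux from it.  With the LOCAL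
glue ✓ `slow_of_constituent_certs` and ✓ `PerPencilPrice.not_slow_of_perPoly_eq_trace` (this seat) the law is needed ONLY for the irreducible
constituents (class pencils of a level-cut constant conjugate, size `≥ ⌊√n⌋ + 1`) of nilpotent affine pencils `N` that REPRESENT the permanent,
`per_n = tr(N^{n−1}·M)`:

* `PerConstituentLaw c n₀` is NOT a definition here (def-free file): the hypothesis is spelled out inline as the binder `hlaw` of
  ★★★ `dualUnipotentThreeHalves_of_perConstituentLaw` — **(c|per) ⇒ `DualUnipotentThreeHalves`** with `C = (c+18)²`, `n₀' = max n₀ 2`.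
* `perConstituentLaw_of_longMassSlowLawInv` — (c) ⇒ (c|per) trivially (drop the extra hypotheses), so nothing priced by crit-7 V27/V34 is lost;
  `dualUnipotentThreeHalves_of_longMassSlowLawInv'` — the crux from (c) through this route (sanity; same constants as the skeleton's).

WHY IT MATTERS (planner note, D-0014 — the prover does not reshape).  (c|per) hands the prover of the research statement the PER-SPECIFIC
structure that (c) throws away: the ambient pencil `N` has price EXACTLY `n(n−1)` (✓ `relCert_iff_of_perPoly_eq_trace`), its value space obeys the
trace constraints `tr(N^j·M) ≡ 0 (j ≠ n−1)` (✓ `…DualUnipotentTraceConstraints` / `…ConstrainedPencil`), the flat/GMS bounds, and the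
constituent inherits the block position inside a `per_n`-representation.  crit-7 V27 recorded «(c) is NOT weaker than S3 … WHY IT MIGHT FAIL: square
pencils `m = n` would get price `≤ c·n^{1.5}` where S3 asks only `< n² − n`»; (c|per) removes exactly that over-strength: it quantifies over no pencil
that does not occur inside a representation of `per_n` below the `n^{3/2}` threshold.  Whether (c|per) is easier is open; it is implied by (c) and
implies the crux, so re-keying the stub to it is truthful.

HONEST FRAMING.  A conditional reduction (`--supports stmt-ValiantsHypothesis-24318 --as helper`); (c), (c|per), S3, the crux 24318, 8062 and
`VP ≠ VNP` are NOT proved.  Def-free, no named-fact hypotheses (the law is an explicit binder), no sorry.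
-/

-- single-conjunct layout: Sub = Summit, duplicated namespace component intended (the name is mandated)
set_option linter.dupNamespace false
set_option autoImplicit false

noncomputable section

namespace Summit.ValiantsHypothesis.ValiantsHypothesis.Theorems.GrenetZeon.SlowCore

open MvPolynomial Matrix
open scoped BigOperators
open Literature.Computability.AlgebraicComplexity (perPoly)
open Summit.ValiantsHypothesis.ValiantsHypothesis.Cruxes.TwoDimCoefficients.DimTwoCases
  (AffMat IsAffine DualUnipotentRepr exists_nilpotent_pencil_of_dualUnipotentRepr)
open Summit.ValiantsHypothesis.ValiantsHypothesis.Theses.GrenetZeon (DualUnipotentThreeHalves)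
open Summit.ValiantsHypothesis.ValiantsHypothesis.Theorems.GrenetZeon.PerPencilPrice
  (not_slow_of_perPoly_eq_trace isAffine_of_isHomogeneous_one)

/-- ★★★ **(c|per) ⇒ THE CRUX.**  If for some `c, n₀` every irreducible nilpotent CONSTITUENT (class pencil of a level-cut constant conjugate, size
`b ≥ ⌊√n⌋ + 1`) of every nilpotent affine pencil `N` REPRESENTING THE PERMANENT (`per_n = tr(N^{n−1}·M)`, `M` affine, `n ≥ n₀`) has a certificate
`RelCert n b B (c·(⌊√n⌋·b))`, then `DualUnipotentThreeHalves` holds with `C = (c+18)²`.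
(Local glue ✓ `slow_of_constituent_certs` + never-slow ✓ `not_slow_of_perPoly_eq_trace` + normal form ✓ `exists_nilpotent_pencil_of_dualUnipotentRepr`.)
[this file] -/
theorem dualUnipotentThreeHalves_of_perConstituentLaw
    (hlaw : ∃ c n₀ : ℕ, ∀ n ≥ n₀, ∀ m : ℕ, ∀ N M : AffMat n m, IsAffine N → N ^ m = 0 → IsAffine M →
      perPoly (Fin n) ℂ = (N ^ (n - 1) * M).trace →
      ∀ (b : ℕ) (B : AffMat n b), IsAffine B → B ^ b = 0 → IrreducibleInv B → Nat.sqrt n + 1 ≤ b →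
        (∃ (G G' : Matrix (Fin m) (Fin m) ℂ) (lvl : Fin m → ℕ) (t : ℕ) (e : {i : Fin m // lvl i = t} ≃ Fin b),
          G' * G = 1 ∧ G * G' = 1 ∧ LevelCut (G.map C * N * G'.map C) lvl ∧ B = classPencil (G.map C * N * G'.map C) e) →
        RelCert n b B (c * (Nat.sqrt n * b))) :
    DualUnipotentThreeHalves := by
  obtain ⟨c, n₀, hlaw⟩ := hlaw
  unfold DualUnipotentThreeHalves
  refine ⟨(c + 18) ^ 2, max n₀ 2, fun n hn m hrep => ?_⟩
  have hn₀ : n₀ ≤ n := le_trans (le_max_left _ _) hn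
  have hn2 : 2 ≤ n := le_trans (le_max_right _ _) hn
  by_contra hlt
  push Not at hlt
  have hrep' : DualUnipotentRepr n m := hrep
  obtain ⟨N, M, hN, hM, hnil, hper⟩ := exists_nilpotent_pencil_of_dualUnipotentRepr (by omega) hrep'
  have hNa := isAffine_of_isHomogeneous_one N hN
  have hMa := isAffine_of_isHomogeneous_one M hM
  exact not_slow_of_perPoly_eq_trace N M hMa hper
    (slow_of_constituent_certs c hn2 hlt N hNa hnil (hlaw n hn₀ m N M hNa hnil hMa hper))

/-- **(c) ⇒ (c|per)** (drop the extra hypotheses): the registered stub implies the weaker law with the same constants. [this file] -/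
theorem perConstituentLaw_of_longMassSlowLawInv (h : LongMassSlowLawInv) :
    ∃ c n₀ : ℕ, ∀ n ≥ n₀, ∀ m : ℕ, ∀ N M : AffMat n m, IsAffine N → N ^ m = 0 → IsAffine M →
      perPoly (Fin n) ℂ = (N ^ (n - 1) * M).trace →
      ∀ (b : ℕ) (B : AffMat n b), IsAffine B → B ^ b = 0 → IrreducibleInv B → Nat.sqrt n + 1 ≤ b →
        (∃ (G G' : Matrix (Fin m) (Fin m) ℂ) (lvl : Fin m → ℕ) (t : ℕ) (e : {i : Fin m // lvl i = t} ≃ Fin b),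
          G' * G = 1 ∧ G * G' = 1 ∧ LevelCut (G.map C * N * G'.map C) lvl ∧ B = classPencil (G.map C * N * G'.map C) e) →
        RelCert n b B (c * (Nat.sqrt n * b)) := by
  obtain ⟨c, n₀, h⟩ := h
  exact ⟨c, n₀, fun n hn _ _ _ _ _ _ _ b B hB hBnil hirr _ _ => h n hn b B hB hBnil hirr⟩

/-- The crux from (c) through (c|per) (sanity: the same constant `(c+18)²` as the skeleton's glue). [this file] -/
theorem dualUnipotentThreeHalves_of_longMassSlowLawInv' (h : LongMassSlowLawInv) : DualUnipotentThreeHalves :=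
  dualUnipotentThreeHalves_of_perConstituentLaw (perConstituentLaw_of_longMassSlowLawInv h)

end Summit.ValiantsHypothesis.ValiantsHypothesis.Theorems.GrenetZeon.SlowCore

end
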